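import Summits.BirchSwinnertonDyer.BirchSwinnertonDyer.Theorems.Rank1ResidualJetCarrierAddKit
import HarnessLib

/-!
# T1 JET (cell `bsd-jet`), bucket B-add (carrier `q = p = 3`, `E` ADDITIVE at `3`): SAMPLE by-name
# records through the kit — `135a1` and `189a1` (Kodaira IV at `3`, `c₃ = 3`, `r_an = 1`)

HONEST FRAMING (programme file §HONESTY, verbatim): «no tranche here proves BSD; ARM L moves the
LITERAL column of an r ≤ 1 census into the kernel-proved-modulo-named-print column». THEOREMS ONLY
(seat `bsd-jet-pv-2`, session g2; `--supports stmt-BirchSwinnertonDyer-14418`, helper). PURPOSE: the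
worked TEMPLATE (for the row generator, seat `bsd-jet-ty`) of the B-add road
`JET.bsdp_of_jetRowCarrierAdd_three_of_frobenius` (`Rank1ResidualJetCarrierAddKit.lean`) on two census
rows (`HOME/census-jet/jet_keys_B_classes.tsv` 4c8599cf93bc5459: `135a1` p = 3 B additive IV c₃ = 3
ord₃ I_K = 1 D = −11; `189a1` p = 3 B additive IV c₃ = 3 ord₃ I_K = 1 D = −20), and the ANTI-VACUITY
check of the kit's numeric hypotheses on real data (every `decide`/`norm_num` goal below closes). The
Heegner datum (`K`, `N`, `P`), the index line `ord₃ [E(K):ℤP] ≤ ord₃ c₃` and `#Ш_an` stay DISPLAYED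
binders (the cell's two-engine index certificates supply them per row; nothing about them is computed
here), as do the READING binder `hJ : JET.JetchevDivisibilityCarrierAdd` and the published `hMcU`,
`hGZK`, `hKo`, `hrec`, `hD36`, `hlev`. CONDITIONAL; nothing is booked; 0 classes move.

Numeric data (Cremona `allcurves`, recomputed in the kernel below): `135a1 = [0,0,1,−3,4]`,
`Δ = −6075 = −3⁵·5²`, `c₄ = 144`, `c₆ = −3672`, `#Ẽ(𝔽₇) = 11` (`a₇ = −3`), `#Ẽ(𝔽₃₇) = 33`
(`a₃₇ = 5`), `#Ẽ(𝔽₂₃) = 18` (`a₂₃ = 6`); `189a1 = [0,0,1,−3,0]`, `Δ = 1701 = 3⁵·7`, `c₄ = 144`,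
`c₆ = −216`, `#Ẽ(𝔽₅) = 7` (`a₅ = −1`), `#Ẽ(𝔽₄₃) = 33` (`a₄₃ = 11`), `#Ẽ(𝔽₂₃) = 30` (`a₂₃ = −6`).

References: [Jetchev2008] Cor. 1.5 (p. 812); [Cremona2006] Table 1; [Serre1972] §2.4 Prop. 15;
[SerreAbelianLadic1968] IV-23; [Elkies2006] Introduction; [Kraus1989] Prop. 1–2.
-/

set_option autoImplicit false

noncomputable section

open scoped Classical

open WeierstrassCurve Literature.NumberTheory.EllipticCurves
  Literature.NumberTheory.EllipticCurves.ModularForms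
  Literature.NumberTheory.EllipticCurves.Rank1Residual
  Literature.NumberTheory.EllipticCurves.Rank1Residual.X11RankOneCertificates
  Summit.BirchSwinnertonDyer.BirchSwinnertonDyer.Rank1Residual
  Summit.BirchSwinnertonDyer.BirchSwinnertonDyer.Rank1Residual.IntModel
  Summit.BirchSwinnertonDyer.BirchSwinnertonDyer.Rank1Residual.X11RankOne
  Summit.BirchSwinnertonDyer.Rank1Residual Summit.BirchSwinnertonDyer.Rank1Residual.X11b

namespace Summit.BirchSwinnertonDyer.Rank1Residual.JET

/-- **`BSD(E,3)` for `135a1` through the bucket-B-add kit** (`N = 135 = 3³·5`; model `[0,0,1,−3,4]`,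
`Δ = −3⁵·5²`, `c₄ = 144`; ADDITIVE (IV) at `3` with `c₃ = 3` — the CARRIER is `3` itself; `r_an = 1`).
Kernel: `Δ ≠ 0`, support `[(3,3,5),(5,1,2)]` with the Silverman disjunct at each prime, `3 ∣ Δ`,
`3 ∣ c₄`, Frobenius witnesses `(7, 11)` irreducible mod `3` (`X² + 1`), `(37, 33)` of order `3`
(`37 ≡ 1`, `a₃₇ = 5 ≡ 2 (mod 3)`, `9 ∤ 33`), `(23, 18)` the mod-`9` certificate (`23 ≡ 5`,
`a₂₃ = 6 (mod 9)`). Displayed binders: `hJ` (READING K4), `hMcU`, `hGZK`, `hKo`, `hrec`, `hD36`, `hlev`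
(published), the Heegner datum and the index line AT THE CARRIER `3`. CONDITIONAL; nothing booked.
[cite: Jetchev2008, Cor. 1.5 (p. 812)] [cite: Cremona2006, Table 1 (label 135a1)]
[cite: Serre1972, §2.4 Prop. 15] [cite: SerreAbelianLadic1968, Ch. IV §3.4 Lemma 3 (IV-23)] -/
theorem bsdp_jetBadd_135a1_3_frobenius
    (hJ : JetchevDivisibilityCarrierAdd)
    (hMcU : McCallum1991_padicValNat_card_sha_primary_add_le_of_globalDivisibility)
    (hGZK : rank_eq_analyticRank_of_analyticRank_le_one)
    (hKo : ∀ (N : ℕ) [NeZero N] (W : WeierstrassCurve ℚ) (K : Type) [Field K] [NumberField K],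
      kolyvagin N W K)
    (hrec : ∀ (N : ℕ) [NeZero N] (W : WeierstrassCurve ℚ) (K : Type) [Field K] [NumberField K],
      heegnerPointOfConductor_one_galoisConj N W K)
    (hD36 : ∀ (N : ℕ) [NeZero N] (W : WeierstrassCurve ℚ) (K : Type) [Field K] [NumberField K],
      phi_heegnerTau_mem_singularModuliField N W K)
    (hlev : ∀ {N : ℕ} [NeZero N], IsNewformOf.level_eq_conductorNorm (N := N))
    (W : WeierstrassCurve ℚ) (hW : W = ⟨0, 0, 1, -3, 4⟩)
    {N : ℕ} [NeZero N] {K : Type} [Field K] [NumberField K] (hK : IsImaginaryQuadratic K)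
    (hD3 : NumberField.discr K ≠ -3) (hD4 : NumberField.discr K ≠ -4)
    (hH : SatisfiesHeegnerHypothesis N K) {P : (W.baseChange K).toAffine.Point}
    (hP : IsHeegnerPoint N W K P) (hnt : ¬ IsOfFinAddOrder P)
    (hI : padicValNat 3 (AddSubgroup.zmultiples P).index ≤
      padicValNat 3 ((W.baseChange ℚ_[3]).localTamagawaNumber ℤ_[3]))
    (hr : W.analyticRank ≤ 1) {s : ℚ} (hs : shaAn W = (s : ℂ)) (hv : padicValRat 3 s = 0) :
    BSDp W 3 :=
  bsdp_of_jetRowCarrierAdd_three_of_frobenius 0 0 1 (-3) 4 (by decide +kernel)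
    [(3, 3, 5), (5, 1, 2)]
    (by intro t ht; simp only [List.mem_cons, List.not_mem_nil, or_false] at ht
        rcases ht with rfl | rfl <;> norm_num)
    (by decide +kernel) (by decide +kernel) (by decide +kernel) (by decide +kernel)
    7 37 23 (by norm_num) (by norm_num) (by norm_num) (by norm_num) (by norm_num) (by norm_num)
    (by norm_num) (by norm_num) (by decide +kernel) (by decide +kernel) (by decide +kernel)
    (n₁ := 11) (n₂ := 33) (n₃ := 18) (by decide +kernel) (by decide +kernel) (by decide +kernel)
    (by decide) (by decide) (by decide) hJ hMcU hGZK hKo hrec hD36 hlev W hW hK hD3 hD4 hH hP hnt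
    hI hr hs hv

/-- **`BSD(E,3)` for `189a1` through the bucket-B-add kit** (`N = 189 = 3³·7`; model `[0,0,1,−3,0]`,
`Δ = 3⁵·7`, `c₄ = 144`; ADDITIVE (IV) at `3` with `c₃ = 3` — the carrier is `3`; `r_an = 1`).
Kernel: `Δ ≠ 0`, support `[(3,3,5),(7,1,1)]` with the Silverman disjunct at each prime, `3 ∣ Δ`,
`3 ∣ c₄`, Frobenius witnesses `(5, 7)` irreducible mod `3` (`X² + X + 2`), `(43, 33)` of order `3`
(`43 ≡ 1`, `a₄₃ = 11 ≡ 2 (mod 3)`, `9 ∤ 33`), `(23, 30)` the mod-`9` certificate (`23 ≡ 5`,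
`a₂₃ = −6 ≡ 3 (mod 9)`). Displayed binders as in `bsdp_jetBadd_135a1_3_frobenius`. CONDITIONAL;
nothing booked. [cite: Jetchev2008, Cor. 1.5 (p. 812)] [cite: Cremona2006, Table 1 (label 189a1)]
[cite: Serre1972, §2.4 Prop. 15] [cite: SerreAbelianLadic1968, Ch. IV §3.4 Lemma 3 (IV-23)] -/
theorem bsdp_jetBadd_189a1_3_frobenius
    (hJ : JetchevDivisibilityCarrierAdd)
    (hMcU : McCallum1991_padicValNat_card_sha_primary_add_le_of_globalDivisibility)
    (hGZK : rank_eq_analyticRank_of_analyticRank_le_one)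
    (hKo : ∀ (N : ℕ) [NeZero N] (W : WeierstrassCurve ℚ) (K : Type) [Field K] [NumberField K],
      kolyvagin N W K)
    (hrec : ∀ (N : ℕ) [NeZero N] (W : WeierstrassCurve ℚ) (K : Type) [Field K] [NumberField K],
      heegnerPointOfConductor_one_galoisConj N W K)
    (hD36 : ∀ (N : ℕ) [NeZero N] (W : WeierstrassCurve ℚ) (K : Type) [Field K] [NumberField K],
      phi_heegnerTau_mem_singularModuliField N W K)
    (hlev : ∀ {N : ℕ} [NeZero N], IsNewformOf.level_eq_conductorNorm (N := N))
    (W : WeierstrassCurve ℚ) (hW : W = ⟨0, 0, 1, -3, 0⟩)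
    {N : ℕ} [NeZero N] {K : Type} [Field K] [NumberField K] (hK : IsImaginaryQuadratic K)
    (hD3 : NumberField.discr K ≠ -3) (hD4 : NumberField.discr K ≠ -4)
    (hH : SatisfiesHeegnerHypothesis N K) {P : (W.baseChange K).toAffine.Point}
    (hP : IsHeegnerPoint N W K P) (hnt : ¬ IsOfFinAddOrder P)
    (hI : padicValNat 3 (AddSubgroup.zmultiples P).index ≤
      padicValNat 3 ((W.baseChange ℚ_[3]).localTamagawaNumber ℤ_[3]))
    (hr : W.analyticRank ≤ 1) {s : ℚ} (hs : shaAn W = (s : ℂ)) (hv : padicValRat 3 s = 0) :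
    BSDp W 3 :=
  bsdp_of_jetRowCarrierAdd_three_of_frobenius 0 0 1 (-3) 0 (by decide +kernel)
    [(3, 3, 5), (7, 1, 1)]
    (by intro t ht; simp only [List.mem_cons, List.not_mem_nil, or_false] at ht
        rcases ht with rfl | rfl <;> norm_num)
    (by decide +kernel) (by decide +kernel) (by decide +kernel) (by decide +kernel)
    5 43 23 (by norm_num) (by norm_num) (by norm_num) (by norm_num) (by norm_num) (by norm_num)
    (by norm_num) (by norm_num) (by decide +kernel) (by decide +kernel) (by decide +kernel)
    (n₁ := 7) (n₂ := 33) (n₃ := 30) (by decide +kernel) (by decide +kernel) (by decide +kernel)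
    (by decide) (by decide) (by decide) hJ hMcU hGZK hKo hrec hD36 hlev W hW hK hD3 hD4 hH hP hnt
    hI hr hs hv

end Summit.BirchSwinnertonDyer.Rank1Residual.JET

end
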